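import Mathlib
import HarnessLib

/-!
# ζ(5) search — moment sequences: products, Beta moments, and determination of the `0`-th moment by the tail (cell `pub-zeta5`, seat ct-1 g15)

HONEST FRAMING: systematic search; no irrationality claim unless kernel-certified. Pure measure theory (Mathlib only);
nothing here is about ζ(5), a worthiness exponent or a denominator.

A MOMENT SEQUENCE is `m(n) = ∫ G^n dμ` for a finite (positive) measure `μ` on some measurable space and a measurable
function `G` with values in `(0,1]` (`IsMoment m`). This file proves:

* `IsMoment.of_density` — `n ↦ ∫ ρ·Gⁿ dμ` is a moment sequence for an integrable a.e.-non-negative density `ρ`;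
* `IsMoment.const`, `IsMoment.mul`, `IsMoment.list_prod` — non-negative constants, pointwise products;
* `IsMoment.factorialRatio` — `n ↦ (n+α)!/(n+M)!` (`α ≤ M`) is a moment sequence (a Beta integral on `(0,1)`:
  `∫₀¹ tᵐ(1−t)ᵏ dt = m!k!/(m+k+1)!`, `intervalIntegral_pow_mul_one_sub_pow`);
* **`IsMoment.eq_zero_of_eventually_eq`** — two moment sequences that agree for all `n ≥ N` agree at `n = 0`.
  Proof: with `u = G^N ∈ (0,1]`, the polynomials `p_k(u) = 1 − (1 − u)^k` lie in the span of `u, u², …`, so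
  `∫ p_k(G^N) dμ` is determined by the moments `m(Nj)`, `j ≥ 1` (an explicit recursion, `tailB_succ`); and
  `p_k(G^N) ↑ 1` pointwise, so `∫ p_k(G^N) dμ → μ(X) = m(0)` by dominated convergence.

Used by `InvarianceGroup.lean`: Brown–Zudilin's cellular integral along the `G`-fixed direction, `n ↦ I(a + n·𝟙)`, is a moment
sequence, and so are the factorial normalisers of (27); the invariance (27) at all large translates `a + n·𝟙` (the ample
ones) therefore forces it at `a` itself. One new definition (`IsMoment`); theorems otherwise.
-/

noncomputable section

namespace Summit.KontsevichZagierPeriods.Zeta5Search.MomentSequences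

open MeasureTheory Set Filter
open scoped Topology ENNReal

/-- A MOMENT SEQUENCE: `m n = ∫ Gⁿ dμ` for a finite measure `μ` on a measurable space (in `Type`) and a measurable `G` with
values in `(0,1]`. -/
def IsMoment (m : ℕ → ℝ) : Prop :=
  ∃ (X : Type) (_ : MeasurableSpace X) (μ : Measure X) (_ : IsFiniteMeasure μ) (G : X → ℝ),
    Measurable G ∧ (∀ x, 0 < G x ∧ G x ≤ 1) ∧ ∀ n, m n = ∫ x, G x ^ n ∂μ

namespace IsMoment

/-! ### Constructors -/

/-- A density form: `n ↦ ∫ ρ·Gⁿ dμ` with `ρ` integrable and a.e. non-negative, `G` measurable with values in `(0,1]`. -/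
theorem of_density {X : Type} [MeasurableSpace X] (μ : Measure X) {ρ : X → ℝ} (hρ : Integrable ρ μ)
    (hρ0 : ∀ᵐ x ∂μ, 0 ≤ ρ x) {G : X → ℝ} (hG : Measurable G) (hG1 : ∀ x, 0 < G x ∧ G x ≤ 1) :
    IsMoment (fun n => ∫ x, ρ x * G x ^ n ∂μ) := by
  haveI : IsFiniteMeasure (μ.withDensity fun x => ENNReal.ofReal (ρ x)) :=
    isFiniteMeasure_withDensity_ofReal hρ.hasFiniteIntegral
  refine ⟨X, inferInstance, μ.withDensity (fun x => ENNReal.ofReal (ρ x)), inferInstance, G, hG, hG1, fun n => ?_⟩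
  rw [integral_withDensity_eq_integral_toReal_smul₀ hρ.aestronglyMeasurable.aemeasurable.ennreal_ofReal
    (Eventually.of_forall fun _ => ENNReal.ofReal_lt_top)]
  refine integral_congr_ae ?_
  filter_upwards [hρ0] with x hx
  rw [ENNReal.toReal_ofReal hx, smul_eq_mul]

/-- A non-negative constant sequence is a moment sequence (a point mass with density `c`, `G = 1`). -/
theorem const {c : ℝ} (hc : 0 ≤ c) : IsMoment (fun _ => c) := by
  have key := of_density (Measure.dirac ()) (integrable_const c) (Eventually.of_forall fun _ => hc)
    (measurable_const (a := (1:ℝ))) (fun _ => ⟨one_pos, le_rfl⟩)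
  simpa using key

/-- The pointwise product of two moment sequences is a moment sequence (product measure, `G(x,y) = G₁(x)G₂(y)`). -/
theorem mul {m₁ m₂ : ℕ → ℝ} (h₁ : IsMoment m₁) (h₂ : IsMoment m₂) : IsMoment (fun n => m₁ n * m₂ n) := by
  obtain ⟨X, _, μ, _, G, hG, hG1, hm₁⟩ := h₁
  obtain ⟨Y, _, ν, _, H, hH, hH1, hm₂⟩ := h₂
  refine ⟨X × Y, inferInstance, μ.prod ν, inferInstance, fun z => G z.1 * H z.2,
    (hG.comp measurable_fst).mul (hH.comp measurable_snd), fun z => ?_, fun n => ?_⟩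
  · obtain ⟨h1, h2⟩ := hG1 z.1
    obtain ⟨h3, h4⟩ := hH1 z.2
    exact ⟨mul_pos h1 h3, mul_le_one₀ h2 h3.le h4⟩
  · show m₁ n * m₂ n = ∫ z, (G z.1 * H z.2) ^ n ∂(μ.prod ν)
    simp_rw [mul_pow]
    rw [hm₁ n, hm₂ n, integral_prod_mul (fun x => G x ^ n) (fun y => H y ^ n)]

/-- A finite product of moment sequences is a moment sequence. -/
theorem list_prod {ι : Type*} (l : List ι) (f : ι → ℕ → ℝ) (h : ∀ i ∈ l, IsMoment (f i)) :
    IsMoment (fun n => (l.map fun i => f i n).prod) := by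
  induction l with
  | nil => simpa using const zero_le_one
  | cons i l ih =>
    simp only [List.map_cons, List.prod_cons]
    exact mul (h i (by simp)) (ih fun j hj => h j (by simp [hj]))

/-! ### The Beta moments `(n+α)!/(n+M)!` -/

/-- `∫₀¹ tᵐ (1−t)ᵏ dt = m!·k!/(m+k+1)!` (Euler's Beta integral at natural arguments, by the recursion in `k`).
[folklore] -/
theorem intervalIntegral_pow_mul_one_sub_pow (m k : ℕ) :
    ∫ t in (0:ℝ)..1, t ^ m * (1 - t) ^ k = (m.factorial * k.factorial : ℝ) / (m + k + 1).factorial := by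
  induction k generalizing m with
  | zero =>
    simp only [pow_zero, mul_one, integral_pow, one_pow, ne_eq, Nat.add_one_ne_zero, not_false_eq_true, zero_pow,
      sub_zero, Nat.factorial_zero, Nat.cast_one, add_zero, Nat.factorial_succ, Nat.cast_mul, Nat.cast_add, Nat.cast_one]
    have hm : (m.factorial : ℝ) ≠ 0 := by positivity
    field_simp
  | succ k ih =>
    have hsplit : (fun t : ℝ => t ^ m * (1 - t) ^ (k + 1)) = fun t => t ^ m * (1 - t) ^ k - t ^ (m + 1) * (1 - t) ^ k := by
      funext t; ring
    have hi1 : IntervalIntegrable (fun t : ℝ => t ^ m * (1 - t) ^ k) volume 0 1 := by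
      apply Continuous.intervalIntegrable; fun_prop
    have hi2 : IntervalIntegrable (fun t : ℝ => t ^ (m + 1) * (1 - t) ^ k) volume 0 1 := by
      apply Continuous.intervalIntegrable; fun_prop
    rw [hsplit, intervalIntegral.integral_sub hi1 hi2, ih m, ih (m + 1)]
    have e1 : (m + 1 + k + 1).factorial = (m + k + 2) * (m + k + 1).factorial := by
      rw [show m + 1 + k + 1 = (m + k + 1) + 1 by ring, Nat.factorial_succ]
    have e2 : (m + (k + 1) + 1).factorial = (m + k + 2) * (m + k + 1).factorial := by
      rw [show m + (k + 1) + 1 = (m + k + 1) + 1 by ring, Nat.factorial_succ]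
    rw [e1, e2, Nat.factorial_succ m, Nat.factorial_succ k]
    push_cast
    have h1 : ((m + k + 1).factorial : ℝ) ≠ 0 := by positivity
    have h2 : ((m : ℝ) + k + 2) ≠ 0 := by positivity
    field_simp
    ring

/-- The clamp of the identity to `(0,1)`: `t` on `(0,1)`, `1` elsewhere (a measurable function with values in `(0,1]`). -/
def clamp01 (t : ℝ) : ℝ := if t ∈ Ioo (0:ℝ) 1 then t else 1

/-- `clamp01` is measurable. -/
theorem measurable_clamp01 : Measurable clamp01 :=
  Measurable.ite measurableSet_Ioo measurable_id measurable_const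

/-- `clamp01` takes values in `(0,1]`. -/
theorem clamp01_mem (t : ℝ) : 0 < clamp01 t ∧ clamp01 t ≤ 1 := by
  unfold clamp01
  split_ifs with h
  · exact ⟨h.1, h.2.le⟩
  · exact ⟨one_pos, le_rfl⟩

/-- **`n ↦ (n+α)!/(n+M)!` is a moment sequence** for `α ≤ M` (for `α < M` it is the Beta integral
`∫₀¹ tⁿ · t^α (1−t)^{M−α−1}/(M−α−1)! dt`; for `α = M` the constant `1`). -/
theorem factorialRatio {α M : ℕ} (h : α ≤ M) :
    IsMoment (fun n => ((n + α).factorial : ℝ) / (n + M).factorial) := by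
  rcases Nat.eq_or_lt_of_le h with rfl | hlt
  · have : (fun n : ℕ => ((n + α).factorial : ℝ) / (n + α).factorial) = fun _ => 1 := by
      funext n; exact div_self (by positivity)
    rw [this]; exact const zero_le_one
  · obtain ⟨k, rfl⟩ : ∃ k, M = α + k + 1 := ⟨M - α - 1, by omega⟩
    -- density `ρ(t) = t^α (1-t)^k / k!` on `(0,1)`, `G = clamp01`
    set ρ : ℝ → ℝ := fun t => t ^ α * (1 - t) ^ k / k.factorial with hρ
    have hρi : Integrable ρ (volume.restrict (Ioo (0:ℝ) 1)) := by
      have hI : IntegrableOn ρ (Icc (0:ℝ) 1) volume := (by fun_prop : Continuous ρ).integrableOn_Icc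
      exact hI.mono_set Ioo_subset_Icc_self
    have hρ0 : ∀ᵐ t ∂(volume.restrict (Ioo (0:ℝ) 1)), 0 ≤ ρ t := by
      filter_upwards [ae_restrict_mem measurableSet_Ioo] with t ht
      have h1 : 0 ≤ 1 - t := by linarith [ht.2]
      exact div_nonneg (mul_nonneg (pow_nonneg ht.1.le _) (pow_nonneg h1 _)) (by positivity)
    have key := of_density (volume.restrict (Ioo (0:ℝ) 1)) hρi hρ0 measurable_clamp01 clamp01_mem
    refine (funext fun n => ?_ : (fun n : ℕ => ((n + α).factorial : ℝ) / (n + (α + k + 1)).factorial) = _) ▸ key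
    -- evaluate the Beta integral
    have hcongr : ∫ t in Ioo (0:ℝ) 1, ρ t * clamp01 t ^ n = ∫ t in Ioo (0:ℝ) 1, (t ^ (n + α) * (1 - t) ^ k) / k.factorial := by
      refine setIntegral_congr_fun measurableSet_Ioo fun t ht => ?_
      simp only [hρ, clamp01, if_pos ht]
      ring
    rw [hcongr, integral_div, ← integral_Ioc_eq_integral_Ioo, ← intervalIntegral.integral_of_le zero_le_one,
      intervalIntegral_pow_mul_one_sub_pow]
    have h1 : ((n + α + k + 1).factorial : ℝ) ≠ 0 := by positivity
    have h2 : (k.factorial : ℝ) ≠ 0 := by positivity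
    rw [show n + (α + k + 1) = n + α + k + 1 by ring]
    field_simp

/-! ### The `0`-th moment is determined by the tail -/

section tail

variable {X : Type} [MeasurableSpace X] (μ : Measure X) {G : X → ℝ}

/-- Bounded measurable functions of `G` of the shape `G^i (1 - G^N)^k` are integrable. -/
theorem integrable_pow_mul [IsFiniteMeasure μ] (hG : Measurable G) (hG1 : ∀ x, 0 < G x ∧ G x ≤ 1) (i N k : ℕ) :
    Integrable (fun x => G x ^ i * (1 - G x ^ N) ^ k) μ := by
  refine Integrable.mono' (integrable_const (1:ℝ)) (by fun_prop) (Eventually.of_forall fun x => ?_)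
  obtain ⟨h0, h1⟩ := hG1 x
  have hGN : G x ^ N ≤ 1 := pow_le_one₀ h0.le h1
  have hGi : G x ^ i ≤ 1 := pow_le_one₀ h0.le h1
  rw [Real.norm_eq_abs, abs_mul, abs_of_nonneg (pow_nonneg h0.le i), abs_of_nonneg (pow_nonneg (by linarith) k)]
  exact mul_le_one₀ hGi (pow_nonneg (by linarith) k) (pow_le_one₀ (by linarith) (by linarith [pow_pos h0 N]))

/-- The auxiliary integrals `A(j,k) = ∫ G^{Nj} (1 - G^N)^k dμ`. -/
def tailA (G : X → ℝ) (N j k : ℕ) : ℝ := ∫ x, G x ^ (N * j) * (1 - G x ^ N) ^ k ∂μ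

/-- `A(j,0) = m(Nj)`. -/
theorem tailA_zero (N j : ℕ) : tailA μ G N j 0 = ∫ x, G x ^ (N * j) ∂μ := by
  simp [tailA]

/-- `A(j,k+1) = A(j,k) − A(j+1,k)`. -/
theorem tailA_succ [IsFiniteMeasure μ] (hG : Measurable G) (hG1 : ∀ x, 0 < G x ∧ G x ≤ 1) (N j k : ℕ) :
    tailA μ G N j (k + 1) = tailA μ G N j k - tailA μ G N (j + 1) k := by
  unfold tailA
  rw [← integral_sub (integrable_pow_mul μ hG hG1 _ _ _) (integrable_pow_mul μ hG hG1 _ _ _)]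
  refine integral_congr_ae (Eventually.of_forall fun x => ?_)
  simp only [Nat.mul_succ, pow_add]
  ring

/-- The truncated integrals `B(k) = ∫ (1 − (1 − G^N)^k) dμ`. -/
def tailB (G : X → ℝ) (N k : ℕ) : ℝ := ∫ x, (1 - (1 - G x ^ N) ^ k) ∂μ

/-- `B(k+1) = B(k) + A(1,k)`: the polynomial `1 − (1−u)^{k+1} − (1 − (1−u)^k) = u(1−u)^k`. -/
theorem tailB_succ [IsFiniteMeasure μ] (hG : Measurable G) (hG1 : ∀ x, 0 < G x ∧ G x ≤ 1) (N k : ℕ) :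
    tailB μ G N (k + 1) = tailB μ G N k + tailA μ G N 1 k := by
  unfold tailB tailA
  have hi : ∀ k, Integrable (fun x => 1 - (1 - G x ^ N) ^ k) μ := fun k => by
    have := (integrable_const (1:ℝ)).sub' (integrable_pow_mul μ hG hG1 0 N k)
    simpa using this
  rw [← integral_add (hi k) (integrable_pow_mul μ hG hG1 _ _ _)]
  refine integral_congr_ae (Eventually.of_forall fun x => ?_)
  simp only [mul_one, pow_succ]
  ring

/-- `B(k) → μ(X)` as `k → ∞` (dominated convergence: `1 − (1 − G^N)^k ↑ 1` pointwise since `0 < G ≤ 1`). -/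
theorem tendsto_tailB [IsFiniteMeasure μ] (hG : Measurable G) (hG1 : ∀ x, 0 < G x ∧ G x ≤ 1) (N : ℕ) :
    Tendsto (fun k => tailB μ G N k) atTop (𝓝 (∫ _x, (1:ℝ) ∂μ)) := by
  unfold tailB
  refine tendsto_integral_of_dominated_convergence (fun _ => (1:ℝ)) (fun k => by fun_prop) (integrable_const 1)
    (fun k => Eventually.of_forall fun x => ?_) (Eventually.of_forall fun x => ?_)
  · obtain ⟨h0, h1⟩ := hG1 x
    have hGN : G x ^ N ≤ 1 := pow_le_one₀ h0.le h1
    have hq : 0 ≤ (1 - G x ^ N) ^ k := pow_nonneg (by linarith) k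
    have hq1 : (1 - G x ^ N) ^ k ≤ 1 := pow_le_one₀ (by linarith) (by linarith [pow_pos h0 N])
    rw [Real.norm_eq_abs, abs_le]
    constructor <;> linarith
  · obtain ⟨h0, h1⟩ := hG1 x
    have hGN : G x ^ N ≤ 1 := pow_le_one₀ h0.le h1
    have hlim : Tendsto (fun k : ℕ => (1 - G x ^ N) ^ k) atTop (𝓝 0) :=
      tendsto_pow_atTop_nhds_zero_of_lt_one (by linarith) (by linarith [pow_pos h0 N])
    simpa using tendsto_const_nhds.sub hlim

end tail

/-- **Two moment sequences that agree for all `n ≥ N` agree at `n = 0`.** (Hausdorff-moment rigidity in the elementary form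
needed here: the `0`-th moment is the limit of integrals of the polynomials `1 − (1 − u)^k ∈ u·ℝ[u]` in `u = G^N`.) [folklore] -/
theorem eq_zero_of_eventually_eq {m₁ m₂ : ℕ → ℝ} (h₁ : IsMoment m₁) (h₂ : IsMoment m₂) {N : ℕ}
    (h : ∀ n, N ≤ n → m₁ n = m₂ n) : m₁ 0 = m₂ 0 := by
  obtain ⟨X, _, μ, _, G, hG, hG1, hm₁⟩ := h₁
  obtain ⟨Y, _, ν, _, H, hH, hH1, hm₂⟩ := h₂
  -- the auxiliary integrals agree for `j ≥ 1`
  have hA : ∀ k j, 1 ≤ j → tailA μ G N j k = tailA ν H N j k := by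
    intro k
    induction k with
    | zero =>
      intro j hj
      rw [tailA_zero, tailA_zero, ← hm₁, ← hm₂]
      exact h _ (Nat.le_mul_of_pos_right N hj)
    | succ k ih =>
      intro j hj
      rw [tailA_succ μ hG hG1, tailA_succ ν hH hH1, ih j hj, ih (j + 1) (by omega)]
  have hB : ∀ k, tailB μ G N k = tailB ν H N k := by
    intro k
    induction k with
    | zero => simp [tailB]
    | succ k ih => rw [tailB_succ μ hG hG1, tailB_succ ν hH hH1, ih, hA k 1 le_rfl]
  have hlim₁ := tendsto_tailB μ hG hG1 N
  have hlim₂ := tendsto_tailB ν hH hH1 N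
  rw [show (fun k => tailB μ G N k) = fun k => tailB ν H N k from funext hB] at hlim₁
  have := tendsto_nhds_unique hlim₁ hlim₂
  rw [hm₁ 0, hm₂ 0]
  simpa using this

end IsMoment

end Summit.KontsevichZagierPeriods.Zeta5Search.MomentSequences

end
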